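import Summits.KontsevichZagierPeriods.KontsevichZagierPeriods.Theorems.LiouvilleUnfoldingAyoubPiLocalKernelDimensionLadder
import Summits.KontsevichZagierPeriods.KontsevichZagierPeriods.Theorems.SymplecticScissorsPlanarCompiler

/-!
# Item stmt-KontsevichZagierPeriods-0541, line `SketchIdeator2`: the rung `d = 1` of the ladder is
# item stmt-KontsevichZagierPeriods-10042 (`SymplecticScissors.RealOnePeriodRelations`)

Support file (`--supports` stmt-KontsevichZagierPeriods-0541, registered stub
`kzKernel_dim_le_one_of_realOnePeriodRelations`).  The dimension ladder
(`…AyoubPiLocalKernelDimensionLadder.lean`) identifies the first open rung of the crux with the planar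
volume form and with Conjecture 1 / Conjecture 7 for formal `ℤ`-combinations of representations of
dimension `≤ 1` (real 1-periods); the rung is spelled out first (`volumeConjecture_two_iff_kzKernel_dim_le_one`,
`volumeForm_two_iff_piLocalKernel_dim_le_one`).  Route SymplecticScissors holds exactly this rung from the other side:
its crux `RealOnePeriodRelations` (stmt-10042, OPEN: Huber–Wüstholz' 1-period theorem "in real clothes" —
every value-`0` combination of one-dimensional representations lies in the subgroup generated by rules
(1a), (1b), (2) and the Green generator on the standard triangle) is COMPILED by the closed crux
`PlanarCompiler` (stmt-10058, `PlanarCompiler_proof`) into `PlanarK0Injective`: equal-area planar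
integrand-`1` representations are connected by planar scissors moves, a fortiori KZ-equivalent.

Hence (this file): **`RealOnePeriodRelations` ⟹ Conjecture 1 on `F_{≤1}`**
(`kzKernel_dim_le_one_of_realOnePeriodRelations`: compile to the planar volume form for ALL finite areas,
then climb down the ladder, `forall_closure_dim_le_of_forall_bodies_succ` with `Q x := (x = 0)`), so the
whole rung `d = 1` of item 0541 — `(A_1)` and the planar `[π]`-local volume form `(B_2)`, with exponent
`N = 0` — is implied by the single open item stmt-10042
(`piLocalKernel_dim_le_one_of_realOnePeriodRelations`, `volumeForm_two_of_realOnePeriodRelations`).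
Conversely the planar volume form gives back Conjecture 1 on `F_{≤1}` (the ladder), though not the finer
four-generator presentation asserted by `RealOnePeriodRelations`.

References: A. Huber, G. Wüstholz, *Transcendence and linear relations of 1-periods* (2022), Thm. 13.3;
J. Cresson, J. Viu-Sos, JTNB 34 (2022), §1; J. Ayoub, EMS Newsl. 91 (2014), Conj. 7; M. Kontsevich,
D. Zagier, *Periods* (2001), §1.2.  No definition is introduced.
-/

noncomputable section

open Set MeasureTheory
open Literature.NumberTheory.Transcendental

namespace Summit.KontsevichZagierPeriods.LiouvilleUnfolding.NilradicalCut

open Summit.KontsevichZagierPeriods.KontsevichZagierPeriods.Theses.SymplecticScissors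
  (RealOnePeriodRelations PlanarK0Injective VolumeForm VolumeFormOffPlane)
open Summit.KontsevichZagierPeriods.SymplecticScissors.PlanarCompilerProof (PlanarCompiler_proof)

/-! ## The rung `d = 1` of the ladder, spelled out -/

/-- **The planar volume conjecture is Conjecture 1 for real 1-periods.**  Cresson–Viu-Sos' volume
conjecture for compact `ℚ`-semialgebraic PLANAR bodies of non-empty interior (equal area ⟹
move-equivalent) is EQUIVALENT to Kontsevich–Zagier's Conjecture 1 for formal `ℤ`-combinations of
representations of dimension `≤ 1` — one-variable real-algebraic integrands over `ℚ`-semialgebraic subsets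
of `ℝ`, whose values are the real 1-periods.  The rational-integrand sub-case of the right-hand side is a
theorem (`Dlog.mem_relations_of_eval_eq_zero_of_dim_le_one`, Baker). [cite: CressonViusos2022, §1 p. 326 Conjecture] -/
theorem volumeConjecture_two_iff_kzKernel_dim_le_one :
    (∀ (K₁ K₂ : KZ.IntegralRep 2), IsCompact K₁.domain → (interior K₁.domain).Nonempty →
        IsCompact K₂.domain → (interior K₂.domain).Nonempty → (∀ x ∈ K₁.domain, K₁.integrand x = 1) →
        (∀ x ∈ K₂.domain, K₂.integrand x = 1) → K₁.value = K₂.value → KZ.Equivalent K₁ K₂) ↔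
      ∀ c ∈ AddSubgroup.closure
        {y : KZ.FormalRep | ∃ (m : ℕ) (r : KZ.IntegralRep m), m ≤ 1 ∧ y = KZ.of r},
        KZ.eval c = 0 → c ∈ KZ.relations :=
  (kzKernel_dim_le_iff_volumeConjecture_succ 1).symm

/-- **The planar `[π]`-local volume form is Conjecture 7 for real 1-periods.**  The first open rung of the
volume form of item 0541 — two compact `ℚ`-semialgebraic planar bodies of non-empty interior and equal area
are move-equivalent after some disc thickening — is EQUIVALENT to the `[π]`-local kernel statement for
formal `ℤ`-combinations of representations of dimension `≤ 1` (real 1-periods).  The printed transcendence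
input here is Huber–Wüstholz' theorem on linear relations of 1-periods; its transfer into the four moves is
not in the tree. [cite: CressonViusos2022, §1 p. 326 Conjecture] -/
theorem volumeForm_two_iff_piLocalKernel_dim_le_one :
    (∀ (K₁ K₂ : KZ.IntegralRep 2), IsCompact K₁.domain → (interior K₁.domain).Nonempty →
        IsCompact K₂.domain → (interior K₂.domain).Nonempty → (∀ x ∈ K₁.domain, K₁.integrand x = 1) →
        (∀ x ∈ K₂.domain, K₂.integrand x = 1) → K₁.value = K₂.value →
        ∃ N : ℕ, KZ.toFormalPeriod (KZ.of KZ.piRep) ^ N *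
          (KZ.toFormalPeriod (KZ.of K₁) - KZ.toFormalPeriod (KZ.of K₂)) = 0) ↔
      ∀ c ∈ AddSubgroup.closure
        {y : KZ.FormalRep | ∃ (m : ℕ) (r : KZ.IntegralRep m), m ≤ 1 ∧ y = KZ.of r},
        KZ.eval c = 0 → ∃ N : ℕ, KZ.toFormalPeriod (KZ.of KZ.piRep) ^ N * KZ.toFormalPeriod c = 0 :=
  (piLocalKernel_dim_le_iff_volumeForm_succ 1).symm

/-! ## The rung `d = 1` is item stmt-10042 -/

/-- **Planar scissors equivalence is KZ-equivalence**: under `PlanarK0Injective` (stmt-9847) two planar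
integrand-`1` representations of equal (finite) area are KZ-equivalent, the planar set-chain group
`closure((domainAddRel ∪ changeOfVariablesRel) ∩ closure{[s] : s planar, integrand 1})` being a subgroup of
`KZ.relations`. [cite: KontsevichZagier2001, §1.2 rules (1),(2)] -/
theorem equivalent_of_planarK0Injective (h : PlanarK0Injective) (r r' : KZ.IntegralRep 2)
    (h1 : ∀ p ∈ r.domain, r.integrand p = 1) (h1' : ∀ p ∈ r'.domain, r'.integrand p = 1)
    (hv : r.value = r'.value) : KZ.Equivalent r r' := by
  have hle : AddSubgroup.closure ((KZ.domainAddRel ∪ KZ.changeOfVariablesRel) ∩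
      (AddSubgroup.closure {x : KZ.FormalRep | ∃ s : KZ.IntegralRep 2,
        (∀ p ∈ s.domain, s.integrand p = 1) ∧ x = KZ.of s} : Set KZ.FormalRep)) ≤ KZ.relations :=
    (AddSubgroup.closure_le _).mpr fun x hx => hx.1.elim (fun hx' => KZ.domainAddRel_subset_relations hx')
      fun hx' => KZ.changeOfVariablesRel_subset_relations hx'
  exact hle (h r r' h1 h1' hv)

/-- **Registered stub `kzKernel_dim_le_one_of_realOnePeriodRelations` — the rung `d = 1` of item 0541 is
item stmt-10042.**  `RealOnePeriodRelations` (Huber–Wüstholz in real clothes, OPEN) implies Kontsevich–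
Zagier's Conjecture 1 for every formal `ℤ`-combination of representations of dimension `≤ 1`: the closed
crux `PlanarCompiler` (stmt-10058) turns it into the planar volume form for all finite areas
(`equivalent_of_planarK0Injective`), and the ladder climbs down one dimension
(`forall_closure_dim_le_of_forall_bodies_succ`, `Q x := (x = 0)`). [cite: HuberWustholz2022, Thm. 13.3] -/
theorem kzKernel_dim_le_one_of_realOnePeriodRelations : Summit.KontsevichZagierPeriods.KontsevichZagierPeriods.Theses.SymplecticScissors.RealOnePeriodRelations → ∀ c ∈ AddSubgroup.closure {y : KZ.FormalRep | ∃ (m : ℕ) (r : KZ.IntegralRep m), m ≤ 1 ∧ y = KZ.of r}, KZ.eval c = 0 → c ∈ KZ.relations := by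
  intro h c hc hv
  have hK0 : PlanarK0Injective := PlanarCompiler_proof h
  rw [← KZ.toFormalPeriod_eq_zero_iff]
  refine forall_closure_dim_le_of_forall_bodies_succ (fun x => x = 0) ?_ hc hv
  intro K₁ K₂ _ _ _ _ h₁ h₂ hv'
  show KZ.toFormalPeriod (KZ.of K₁) - KZ.toFormalPeriod (KZ.of K₂) = 0
  rw [sub_eq_zero, KZ.toFormalPeriod_eq_iff]
  exact equivalent_of_planarK0Injective hK0 K₁ K₂ h₁ h₂ hv'

/-- **`(A_1)` of item 0541 from stmt-10042, exponent `0`**: under `RealOnePeriodRelations` every value-`0`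
formal combination of representations of dimension `≤ 1` is killed in the formal period ring already by
`ϖ ^ 0`. [cite: HuberWustholz2022, Thm. 13.3] -/
theorem piLocalKernel_dim_le_one_of_realOnePeriodRelations (h : RealOnePeriodRelations) :
    ∀ c ∈ AddSubgroup.closure
      {y : KZ.FormalRep | ∃ (m : ℕ) (r : KZ.IntegralRep m), m ≤ 1 ∧ y = KZ.of r},
      KZ.eval c = 0 → ∃ N : ℕ, KZ.toFormalPeriod (KZ.of KZ.piRep) ^ N * KZ.toFormalPeriod c = 0 :=
  fun c hc hv => ⟨0, by
    rw [pow_zero, one_mul]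
    exact KZ.toFormalPeriod_eq_zero_of_mem (kzKernel_dim_le_one_of_realOnePeriodRelations h c hc hv)⟩

/-- **`(B_2)` of item 0541 from stmt-10042, exponent `0`, all finite areas**: under `RealOnePeriodRelations`
two planar integrand-`1` representations of equal area have the same formal period (the planar `[π]`-local
volume form with `N = 0`; no compactness needed). [cite: HuberWustholz2022, Thm. 13.3] -/
theorem volumeForm_two_of_realOnePeriodRelations (h : RealOnePeriodRelations) (K₁ K₂ : KZ.IntegralRep 2)
    (h₁ : ∀ x ∈ K₁.domain, K₁.integrand x = 1) (h₂ : ∀ x ∈ K₂.domain, K₂.integrand x = 1)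
    (hv : K₁.value = K₂.value) :
    ∃ N : ℕ, KZ.toFormalPeriod (KZ.of KZ.piRep) ^ N *
      (KZ.toFormalPeriod (KZ.of K₁) - KZ.toFormalPeriod (KZ.of K₂)) = 0 :=
  ⟨0, by
    rw [pow_zero, one_mul, sub_eq_zero, KZ.toFormalPeriod_eq_iff]
    exact equivalent_of_planarK0Injective (PlanarCompiler_proof h) K₁ K₂ h₁ h₂ hv⟩

/-- **The volume form in dimension `≤ 2` from stmt-10042** (rungs `d = 0`, a theorem, and `d = 1`): under
`RealOnePeriodRelations`, two integrand-`1` representations of one dimension `D ≤ 2` and equal volume are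
KZ-equivalent. [cite: HuberWustholz2022, Thm. 13.3] -/
theorem equivalent_of_integrand_one_of_dim_le_two (h : RealOnePeriodRelations) {D : ℕ} (hD : D ≤ 2)
    (K₁ K₂ : KZ.IntegralRep D) (h₁ : ∀ x ∈ K₁.domain, K₁.integrand x = 1)
    (h₂ : ∀ x ∈ K₂.domain, K₂.integrand x = 1) (hv : K₁.value = K₂.value) : KZ.Equivalent K₁ K₂ := by
  rcases Nat.lt_or_ge D 1 with hD0 | hD1
  · -- `D = 0`: both domains are the point or empty; two Newton–Leibniz slabs and the rung `d = 0`
    obtain rfl : D = 0 := Nat.lt_one_iff.mp hD0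
    have e₁ := K₁.equivalent_slab 0
    have e₂ := K₂.equivalent_slab 0
    have hs : KZ.Equivalent (K₁.slab 0) (K₂.slab 0) :=
      equivalent_of_integrand_one_dim_one _ _ (K₁.slab_integrand_eq_one 0 h₁)
        (K₂.slab_integrand_eq_one 0 h₂)
        (by rw [← KZ.Equivalent.value_eq_holds e₁, ← KZ.Equivalent.value_eq_holds e₂, hv])
    exact (e₁.trans hs).trans e₂.symm
  · -- `D = d + 1` with `d ≤ 1`: compile and climb down
    obtain ⟨d, rfl⟩ := Nat.exists_eq_add_of_le' hD1
    have key : KZ.toFormalPeriod (KZ.of K₁) - KZ.toFormalPeriod (KZ.of K₂) = 0 :=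
      forall_bodies_succ_of_forall_closure_dim_le (fun x => x = 0)
        (forall_closure_dim_le_mono (by omega) (fun x => x = 0)
          fun c hc hv' => KZ.toFormalPeriod_eq_zero_of_mem
            (kzKernel_dim_le_one_of_realOnePeriodRelations h c hc hv'))
        K₁ K₂ h₁ h₂ hv
    rwa [sub_eq_zero, KZ.toFormalPeriod_eq_iff] at key

/-- **The volume form gets harder with the dimension — remark for route SymplecticScissors**: its frame
hypothesis off the plane, `VolumeFormOffPlane` (stmt-14935: equal-volume integrand-`1` representations of
every dimension `N ≠ 2` are KZ-equivalent), already implies the full frame `VolumeForm` (stmt-3814): thicken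
two equal-area planar representations by the unit slab (one Newton–Leibniz move each) and use the case
`N = 3`.  So the planar layer (`PlanarAreas`, `PlanarK0Injective`) is not needed for that route's frame split;
cf. `forall_bodies_succ_mono`. [cite: CressonViusos2022, §1 p. 326] -/
theorem volumeForm_of_volumeFormOffPlane (h : VolumeFormOffPlane) : VolumeForm := by
  intro N r r' h1 h1' hv
  by_cases hN : N = 2
  · subst hN
    have e₁ := r.equivalent_slab 0
    have e₂ := r'.equivalent_slab 0
    have hs : KZ.Equivalent (r.slab 0) (r'.slab 0) :=
      h (by omega) _ _ (r.slab_integrand_eq_one 0 h1) (r'.slab_integrand_eq_one 0 h1')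
        (by rw [← KZ.Equivalent.value_eq_holds e₁, ← KZ.Equivalent.value_eq_holds e₂, hv])
    exact (e₁.trans hs).trans e₂.symm
  · exact h hN r r' h1 h1' hv

/-- Hence `VolumeFormOffPlane ↔ VolumeForm` (the converse is the restriction to `N ≠ 2`). [folklore] -/
theorem volumeFormOffPlane_iff_volumeForm : VolumeFormOffPlane ↔ VolumeForm :=
  ⟨volumeForm_of_volumeFormOffPlane, fun h _ _ r r' h1 h1' hv => h r r' h1 h1' hv⟩

end Summit.KontsevichZagierPeriods.LiouvilleUnfolding.NilradicalCut

end
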